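import Summits.KontsevichZagierPeriods.KontsevichZagierPeriods.Theorems.HurwitzMicroSectorsNormalFormPrincipleLevelOneReduction
import Summits.KontsevichZagierPeriods.KontsevichZagierPeriods.Theorems.HurwitzMicroSectorsNormalFormPrincipleLevelOneRigidNumbers

/-!
# `NormalFormPrinciple` (stmt-KontsevichZagierPeriods-3869), line `SketchIdeator1` — the leaf
# `stub_boxRigidity` in DIMENSION TWO, level one, II: Conjecture 1 for `[(0,1)², P(x,y)/(1 − xy)]`

Pure proof file (lead seat c7; `--supports` the crux; registered sub-goals
`boxRigidity_levelOne_dim_two`, `mem_relations_of_eval_eq_zero_of_mem_closure`,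
`levelOne_equivalent_boxPoly_of_value_eq`; the reduction `levelOne_reduce` is the companion file
`…LevelOneReduction.lean`). The registered leaf `stub_boxRigidity` (Conjecture 1 of
Kontsevich–Zagier frozen to box-rational representations) is a theorem in dimension `≤ 1`
(`…BoxRigidityDimOne`, `…DimOneAssembly`) and on the unicoordinate family (`…BoxUnicoordRigidity`).
This file opens DIMENSION TWO with Kontsevich–Zagier's own showcase family: all representations
`[(0,1)², P(x₀,x₁)/(1 − x₀x₁)]`, `P ∈ ℚ[x₀,x₁]`, whose values fill `ℚ + ℚζ(2)`
(`∫∫ x₀^a x₁^b/(1 − x₀x₁) = Σₙ 1/((n+a+1)(n+b+1))`). UNCONDITIONALLY: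

* `levelOne_reduce` — every such representation is congruent modulo KZ relations to the normal form
  `[(0,1)², β/(1 − x₀x₁)] + [pt, q]`, `β, q ∈ ℚ`. Engine (card `merge-gadget-join-rung` of the crux):
  an OFF-DIAGONAL monomial `c x₀^a x₁^b`, `a > b`, is sent by the merge gadget `(x₀,x₁) ↦ (x₀, x₀x₁)`
  (rule 2, the affine substitution along the last coordinate; `merge_box_sub_triangle`) onto the
  triangle `{0 < z₀ < 1, 0 ≤ z₁ ≤ z₀}` with integrand `c z₀^{a−b−1} z₁^b/(1 − z₁)`, where one
  Newton–Leibniz move along `z₀` (rule 3; `triangle_sub_dimOne`) leaves the POLYNOMIAL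
  `(c/(a−b)) s^b Σ_{i<a−b} s^i` on `(0,1)`, which collapses to a rational point (`boxPoly_exists_pt`,
  the Unicoord engine); `a < b` by the symmetry `x₀ ↔ x₁` (rule 2); a DIAGONAL monomial is
  `c/(1 − x₀x₁)` minus a polynomial (rule 1b, geometric sum); sums by integrand additivity;
* `levelOne_value` — the value is `β·π²/6 + q` (`∫∫ dx₀dx₁/(1 − x₀x₁) = ζ(2) = π²/6`, Beukers);
* `boxRigidity_levelOne_dim_two` — **Conjecture 1 on the family**: equal values ⇒ KZ-equivalent,
  because `π² ∉ ℚ` (`CalegariDimitrovTang.irrational_pi_sq`, Lindemann) compares the coefficients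
  (`levelOne_rigid_numbers`) and two representations with a common normal form are equivalent;
* `mem_relations_of_eval_eq_zero_of_mem_closure` — the kernel form on the subgroup generated by the
  family and all polynomial boxes `[(0,1)ᵐ, p]` (`KZ.PiLocalKernel` with exponent `0` there);
* `levelOne_equivalent_boxPoly_of_value_eq` — the mixed pairs: a level-one box against a polynomial
  box of any dimension (in particular a rational point);
* `boxRigidity_levelOne` — the same in the `IsRational` vocabulary of the leaf.

The seven registered sub-goals of the wave live in the files `…LevelOneExistsRep`,
`…LevelOneExistsTriangleRep`, `…LevelOneMergeBoxSubTriangle`, `…LevelOneTriangleSubDimOne`,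
`…LevelOneBoxPolyExistsPt`, `…LevelOneRigidNumbers`, `…LevelOneValueZetaTwoRep`.
Sources: M. Kontsevich, D. Zagier, *Periods* (2001), §1.1 (the example `ζ(2)`), §1.2 Conjecture 1
and rules (1)–(3); F. Beukers, *A note on the irrationality of ζ(2) and ζ(3)*, Bull. LMS 11 (1979).
No definitions are introduced.
-/

noncomputable section

open MeasureTheory Set
open scoped Polynomial
open Literature.NumberTheory.Transcendental Literature.NumberTheory.Transcendental.KZ
open Literature.ModelTheory.ExponentialFields (IsSemialgebraic)

namespace Summit.KontsevichZagierPeriods.HurwitzMicroSectors.NormalFormPrinciple.PiBox.LevelOne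

open Summit.KontsevichZagierPeriods.HurwitzMicroSectors.NormalFormPrinciple.PiBox.Dlog
  (exists_ptCarrier value_pt pt_add_mem_relations pt_zero_mem_relations pt_congr_mem_relations)

/-! ## Composition (lead) -/

/-! ### The layer: Conjecture 1 on `[(0,1)², P/(1 − x₀x₁)]` -/

/-- **`stub_boxRigidity` in dimension two, level one (Conjecture 1 of Kontsevich–Zagier for their
showcase family, unconditionally).** Two representations on the open unit box `(0,1)²` with integrands
`P(x₀,x₁)/(1 − x₀x₁)`, `P'(x₀,x₁)/(1 − x₀x₁)` (`P, P' ∈ ℚ[x₀,x₁]`) and equal values are KZ-equivalent: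
both reduce to normal forms `[(0,1)², β/(1 − x₀x₁)] + [pt, q]` (`levelOne_reduce`), the values
`β·π²/6 + q` agree, `π² ∉ ℚ` forces `(β, q) = (β', q')` (`levelOne_rigid_numbers`), and two
representations with a common normal form are equivalent. Values covered: `ℚ + ℚζ(2)`, e.g.
`∫∫ dxdy/(1−xy) = ζ(2)`, `∫∫ (x − 3x²y²) dxdy/(1−xy) = 1/2 + … `. [cite: KontsevichZagier2001, §1.2 Conjecture 1] -/
theorem boxRigidity_levelOne_dim_two (N N' : IntegralRep 2) (P P' : MvPolynomial (Fin 2) ℚ)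
    (hNd : N.domain = {x | ∀ i, x i ∈ Set.Ioo (0:ℝ) 1})
    (hNi : EqOn N.integrand (fun x => (MvPolynomial.aeval x P : ℝ) / (1 - x 0 * x 1)) N.domain)
    (hN'd : N'.domain = {x | ∀ i, x i ∈ Set.Ioo (0:ℝ) 1})
    (hN'i : EqOn N'.integrand (fun x => (MvPolynomial.aeval x P' : ℝ) / (1 - x 0 * x 1)) N'.domain)
    (hv : N.value = N'.value) : Equivalent N N' := by
  obtain ⟨β, q, h⟩ := levelOne_reduce P N hNd hNi
  obtain ⟨β', q', h'⟩ := levelOne_reduce P' N' hN'd hN'i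
  have hvN := levelOne_value h
  have hvN' := levelOne_value h'
  obtain ⟨rfl, rfl⟩ := levelOne_rigid_numbers β q β' q' (by rw [← hvN, ← hvN', hv])
  obtain ⟨B, hBd, hBi⟩ := exists_zetaTwoRep β
  obtain ⟨Zf, hZf⟩ := exists_ptCarrier
  have e₁ := h B (Zf q) hBd hBi (hZf q).1 (hZf q).2
  have e₂ := h' B (Zf q) hBd hBi (hZf q).1 (hZf q).2
  have e : of N - of N' = (of N - of B - of (Zf q)) - (of N' - of B - of (Zf q)) := by abel
  show of N - of N' ∈ relations
  rw [e]
  exact relations.sub_mem e₁ e₂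

/-! ### Kernel form on the subgroup generated by the family and the polynomial boxes -/

/-- **Normal forms on the subgroup.** Every element of the subgroup of `FormalRep` generated by the
level-one box representations `[(0,1)², P/(1 − x₀x₁)]` and the polynomial boxes `[(0,1)ᵐ, p]` (all `m`;
`m = 0` are the rational points) differs by relations from a normal form `[(0,1)², β/(1 − x₀x₁)] + [pt, q]`
(generator by generator: `levelOne_reduce`, `boxPoly_exists_pt`; sums and negatives by integrand
additivity). [cite: KontsevichZagier2001, §1.2] -/
theorem exists_normalForm_of_mem_closure {c : FormalRep}
    (hc : c ∈ AddSubgroup.closure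
      ({y : FormalRep | ∃ (P : MvPolynomial (Fin 2) ℚ) (N : IntegralRep 2),
          N.domain = {x | ∀ i, x i ∈ Set.Ioo (0:ℝ) 1} ∧
          EqOn N.integrand (fun x => (MvPolynomial.aeval x P : ℝ) / (1 - x 0 * x 1)) N.domain ∧
          y = of N} ∪
       {y : FormalRep | ∃ (m : ℕ) (p : MvPolynomial (Fin m) ℚ) (N : IntegralRep m),
          N.domain = {x | ∀ i, x i ∈ Set.Ioo (0:ℝ) 1} ∧
          EqOn N.integrand (fun x => (MvPolynomial.aeval x p : ℝ)) N.domain ∧ y = of N})) :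
    ∃ β q : ℚ, ∀ (B : IntegralRep 2) (Z : IntegralRep 0),
      B.domain = {x | ∀ i, x i ∈ Set.Ioo (0:ℝ) 1} →
      EqOn B.integrand (fun x => (β : ℝ) / (1 - x 0 * x 1)) B.domain →
      Z.domain = Set.univ → (Z.integrand = fun _ => (q : ℝ)) →
      c - of B - of Z ∈ relations := by
  obtain ⟨Zf, hZf⟩ := exists_ptCarrier
  induction hc using AddSubgroup.closure_induction with
  | mem y hy =>
    rcases hy with ⟨P, N, hNd, hNi, rfl⟩ | ⟨m, p, N, hNd, hNi, rfl⟩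
    · exact levelOne_reduce P N hNd hNi
    · obtain ⟨q, hq⟩ := boxPoly_exists_pt p N hNd hNi
      refine ⟨0, q, fun B Z hBd hBi hZd hZi => ?_⟩
      have e : of N - of B - of Z = (of N - of Z) - of B := by abel
      rw [e]
      exact relations.sub_mem (hq Z hZd hZi) (zetaTwoRep_zero_mem_relations B hBi)
  | zero =>
    refine ⟨0, 0, fun B Z hBd hBi hZd hZi => ?_⟩
    have e : (0 : FormalRep) - of B - of Z = -(of B) - of Z := by abel
    rw [e]
    exact relations.sub_mem (relations.neg_mem (zetaTwoRep_zero_mem_relations B hBi))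
      (pt_zero_mem_relations Z (by rw [hZi]; push_cast; rfl))
  | add y z _ _ ihy ihz =>
    obtain ⟨β₁, q₁, h₁⟩ := ihy
    obtain ⟨β₂, q₂, h₂⟩ := ihz
    refine ⟨β₁ + β₂, q₁ + q₂, fun B Z hBd hBi hZd hZi => ?_⟩
    obtain ⟨B₁, hB₁d, hB₁i⟩ := exists_zetaTwoRep β₁
    obtain ⟨B₂, hB₂d, hB₂i⟩ := exists_zetaTwoRep β₂
    have e₁ := h₁ B₁ (Zf q₁) hB₁d hB₁i (hZf q₁).1 (hZf q₁).2
    have e₂ := h₂ B₂ (Zf q₂) hB₂d hB₂i (hZf q₂).1 (hZf q₂).2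
    have eB := zetaTwoRep_add_mem_relations B B₁ B₂ hBd hBi hB₁d hB₁i hB₂d hB₂i
    have eZ := pt_add_mem_relations Z (Zf q₁) (Zf q₂) hZd (hZf q₁).1 (hZf q₂).1
      (by rw [hZi]; push_cast; rfl) (hZf q₁).2 (hZf q₂).2
    have e : y + z - of B - of Z = (y - of B₁ - of (Zf q₁)) + (z - of B₂ - of (Zf q₂)) -
        (of B - of B₁ - of B₂) - (of Z - of (Zf q₁) - of (Zf q₂)) := by abel
    rw [e]
    exact relations.sub_mem (relations.sub_mem (relations.add_mem e₁ e₂) eB) eZ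
  | neg y _ ih =>
    obtain ⟨β, q, h⟩ := ih
    refine ⟨-β, -q, fun B Z hBd hBi hZd hZi => ?_⟩
    obtain ⟨B₁, hB₁d, hB₁i⟩ := exists_zetaTwoRep β
    have e₁ := h B₁ (Zf q) hB₁d hB₁i (hZf q).1 (hZf q).2
    -- `[B] + [B₁] ∈ relations` and `[Z] + [Zf q] ∈ relations` (opposite integrands)
    have eB : of B₁ + of B ∈ relations :=
      of_add_of_mem_relations_of_eqOn_neg (hBd.trans hB₁d.symm) fun x hx => by
        rw [Pi.neg_apply, hB₁i hx, hBi (by rw [hBd, ← hB₁d]; exact hx)]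
        push_cast
        ring
    have eZ : of (Zf q) + of Z ∈ relations :=
      of_add_of_mem_relations_of_eqOn_neg (hZd.trans (hZf q).1.symm) fun x _ => by
        rw [Pi.neg_apply, (hZf q).2, hZi]
        push_cast
        ring
    have e : -y - of B - of Z = -(y - of B₁ - of (Zf q)) - (of B₁ + of B) - (of (Zf q) + of Z) := by
      abel
    rw [e]
    exact relations.sub_mem (relations.sub_mem (relations.neg_mem e₁) eB) eZ

/-- **Conjecture 1, kernel form, on the subgroup generated by the level-one box representations and
the polynomial boxes** (unconditionally): a formal `ℤ`-combination of such representations with value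
`0` is a Kontsevich–Zagier relation. Its normal form `[(0,1)², β/(1−x₀x₁)] + [pt, q]` has value
`β·π²/6 + q = 0`, so `β = q = 0` (`levelOne_rigid_numbers`), and the normal form with `β = q = 0` is a
relation. [cite: KontsevichZagier2001, §1.2 Conjecture 1] -/
theorem mem_relations_of_eval_eq_zero_of_mem_closure {c : FormalRep}
    (hc : c ∈ AddSubgroup.closure
      ({y : FormalRep | ∃ (P : MvPolynomial (Fin 2) ℚ) (N : IntegralRep 2),
          N.domain = {x | ∀ i, x i ∈ Set.Ioo (0:ℝ) 1} ∧
          EqOn N.integrand (fun x => (MvPolynomial.aeval x P : ℝ) / (1 - x 0 * x 1)) N.domain ∧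
          y = of N} ∪
       {y : FormalRep | ∃ (m : ℕ) (p : MvPolynomial (Fin m) ℚ) (N : IntegralRep m),
          N.domain = {x | ∀ i, x i ∈ Set.Ioo (0:ℝ) 1} ∧
          EqOn N.integrand (fun x => (MvPolynomial.aeval x p : ℝ)) N.domain ∧ y = of N}))
    (hv : eval c = 0) : c ∈ relations := by
  obtain ⟨β, q, h⟩ := exists_normalForm_of_mem_closure hc
  obtain ⟨B, hBd, hBi⟩ := exists_zetaTwoRep β
  obtain ⟨Zf, hZf⟩ := exists_ptCarrier
  have e₁ := h B (Zf q) hBd hBi (hZf q).1 (hZf q).2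
  have h0 := relations_le_ker_eval_holds e₁
  rw [AddMonoidHom.mem_ker, map_sub, map_sub, hv, eval_of, eval_of,
    value_zetaTwoRep β B hBd hBi, value_pt (Zf q) (hZf q).1 (hZf q).2] at h0
  obtain ⟨rfl, rfl⟩ := levelOne_rigid_numbers β q 0 0 (by push_cast; linarith)
  have eB := zetaTwoRep_zero_mem_relations B hBi
  have eZ := pt_zero_mem_relations (Zf 0) (by rw [(hZf 0).2]; push_cast; rfl)
  have e : c = (c - of B - of (Zf 0)) + of B + of (Zf 0) := by abel
  rw [e]
  exact relations.add_mem (relations.add_mem e₁ eB) eZ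

/-- **Mixed pairs: a level-one box against a polynomial box of any dimension** (in particular against
a rational point, `m = 0`): equal values imply KZ-equivalence. Here `π² ∉ ℚ` forces `β = 0`.
[cite: KontsevichZagier2001, §1.2 Conjecture 1] -/
theorem levelOne_equivalent_boxPoly_of_value_eq {m : ℕ} (N : IntegralRep 2) (N' : IntegralRep m)
    (P : MvPolynomial (Fin 2) ℚ) (p : MvPolynomial (Fin m) ℚ)
    (hNd : N.domain = {x | ∀ i, x i ∈ Set.Ioo (0:ℝ) 1})
    (hNi : EqOn N.integrand (fun x => (MvPolynomial.aeval x P : ℝ) / (1 - x 0 * x 1)) N.domain)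
    (hN'd : N'.domain = {x | ∀ i, x i ∈ Set.Ioo (0:ℝ) 1})
    (hN'i : EqOn N'.integrand (fun x => (MvPolynomial.aeval x p : ℝ)) N'.domain)
    (hv : N.value = N'.value) : Equivalent N N' := by
  refine mem_relations_of_eval_eq_zero_of_mem_closure (AddSubgroup.sub_mem _
    (AddSubgroup.subset_closure (Or.inl ⟨P, N, hNd, hNi, rfl⟩))
    (AddSubgroup.subset_closure (Or.inr ⟨m, p, N', hN'd, hN'i, rfl⟩))) ?_
  rw [map_sub, eval_of, eval_of, hv, sub_self]

/-- **The layer in the vocabulary of the registered leaf `stub_boxRigidity`** (`IsRational` data with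
the level-one denominator): two representations on `(0,1)²` whose integrands agree on the box with
`p/q`, `p ∈ ℚ[x₀,x₁]`, `q = 1 − x₀x₁`, and whose values agree are KZ-equivalent.
[cite: KontsevichZagier2001, §1.2 Conjecture 1] -/
theorem boxRigidity_levelOne (N N' : IntegralRep 2)
    (hNd : N.domain = {x | ∀ i, x i ∈ Set.Ioo (0:ℝ) 1})
    (hN : ∃ p : MvPolynomial (Fin 2) ℚ, EqOn N.integrand
      (fun x => (MvPolynomial.aeval x p : ℝ) /
        MvPolynomial.aeval x (1 - MvPolynomial.X 0 * MvPolynomial.X 1 : MvPolynomial (Fin 2) ℚ))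
      N.domain)
    (hN'd : N'.domain = {x | ∀ i, x i ∈ Set.Ioo (0:ℝ) 1})
    (hN' : ∃ p : MvPolynomial (Fin 2) ℚ, EqOn N'.integrand
      (fun x => (MvPolynomial.aeval x p : ℝ) /
        MvPolynomial.aeval x (1 - MvPolynomial.X 0 * MvPolynomial.X 1 : MvPolynomial (Fin 2) ℚ))
      N'.domain)
    (hv : N.value = N'.value) : Equivalent N N' := by
  obtain ⟨P, hP⟩ := hN
  obtain ⟨P', hP'⟩ := hN'
  refine boxRigidity_levelOne_dim_two N N' P P' hNd (fun x hx => ?_) hN'd (fun x hx => ?_) hv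
  · rw [hP hx]; simp
  · rw [hP' hx]; simp

end Summit.KontsevichZagierPeriods.HurwitzMicroSectors.NormalFormPrinciple.PiBox.LevelOne

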